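import Summits.SmoothPoincare4.SmoothPoincare4.Theorems.ConvexBisectionAcyclicBisectionRigiditySeamGluingProfile
import Summits.SmoothPoincare4.SmoothPoincare4.Theorems.ConvexBisectionAcyclicBisectionRigiditySeamGluingTransport
import Summits.SmoothPoincare4.SmoothPoincare4.Theorems.ConvexBisectionAcyclicBisectionRigiditySeamGluingLocal
import Literature.Topology.FourManifolds.BoundaryGluingConstruction
import Literature.Topology.FourManifolds.OpenCollarExistence
import Literature.Topology.FourManifolds.MorseHeightCollar
import Literature.Topology.FourManifolds.MorseProofs
import HarnessLib

/-!
# Seam gluing of Morse functions, IV: the model gluing carries a glued Morse function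

Helper file (lead c1, crux `ConvexBisection.AcyclicBisectionRigidity`, item
stmt-SmoothPoincare4-10507; the typed packaging step "(L)" of the cross-seam levers
`stub_seamPairDichotomy` / `stub_crossCancellation`).

**Theorem** (`exists_isMorse_glued`).  Let `M`, `N` be compact smooth `(n+2)`-manifolds with
(nonempty) boundary, `f_M`, `f_N` Morse functions adapted to the boundary (`= 1` and regular on the
boundary, `< 1` inside) and `φ : ∂M ≅ ∂N`.  Then the tree's model gluing `P₀ = M ∪_φ N`
(`BoundaryGlueData.d₂.Glued` for the flow-out collars of `1 - f_M`, `1 - f_N`) carries a Morse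
function `F` whose critical points of index `i` number `#Crit_i(f_M) + #Crit_j(f_N)` for
`i + j = n + 2`.

Proof (Milnor, *Lectures on the h-cobordism theorem* (1965), §1 and proof of Thm. 3.4: collars along
which the Morse function is the height; *Morse theory* (1963), §2).  Along the flow-out collar of
`M`, `1 - f_M (collar x s) = collarStretch a_M s`; put `F = 1 - B (1 - f_M)` on `M` and
`F = 1 + A (1 - f_N)` on `N` with the reparametrisations of `exists_seamProfile`: on the seam piece
`∂M × ℝ` the function is `σ (t)` — smooth with `σ' < 0`, so `F` is smooth with no critical point
near the seam; the critical points of `F` are those of `f_M` (index kept: near them `F` is an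
increasing affine function of `f_M`, because they lie outside the collar region where `B` is linear)
and those of `f_N` (index complemented: a decreasing affine function of `f_N`).

Everything is proved; no definitions. [folklore]
-/

noncomputable section

open scoped Manifold ContDiff Topology
open Set Function Filter Literature.Topology.FourManifolds

-- the prescribed namespace `Summit.<P>.<Sub>.…` duplicates `SmoothPoincare4` (P = Sub)
set_option linter.dupNamespace false

namespace Summit.SmoothPoincare4.SmoothPoincare4.Theorems.AcyclicBisectionRigidity.SeamGluing

universe u

variable {n : ℕ} {M N : Type u}
  [TopologicalSpace M] [T2Space M] [CompactSpace M] [ChartedSpace (EuclideanHalfSpace (n + 2)) M]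
  [IsManifold (𝓡∂ (n + 2)) ∞ M]
  [TopologicalSpace N] [T2Space N] [CompactSpace N] [ChartedSpace (EuclideanHalfSpace (n + 2)) N]
  [IsManifold (𝓡∂ (n + 2)) ∞ N]
  {bM : BoundaryData (𝓡∂ (n + 2)) M (𝓡 (n + 1))} {bN : BoundaryData (𝓡∂ (n + 2)) N (𝓡 (n + 1))}
  [Nonempty bM.carrier] [Nonempty bN.carrier]

/-- Local notation: the model space `ℝⁿ⁺²` of the glued manifold. -/
local notation "𝔼₂" => EuclideanSpace ℝ (Fin (n + 2))

/-! ### The glued function on a model gluing, its values on the pieces -/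

omit [T2Space M] [CompactSpace M] [T2Space N] [CompactSpace N] [Nonempty bN.carrier] in
/-- **The glued function and its three restrictions.**  For gluing data `G` whose collars are the
flow-out collars of `1 - f_M` and `1 - f_N` (heights `b`, `a`), and reparametrisations `A`, `B`,
`σ` as in `exists_seamProfile`, there is a smooth `F : M ∪_φ N → ℝ` with `F = σ (t)` on the seam
piece, `F = 1 - B (1 - f_M)` on the interior of `M` and `F = 1 + A (1 - f_N)` on the interior of
`N` (descent to the two pushouts). [folklore] -/
theorem exists_glued_function (G : BoundaryGlueData bM bN) {fM : M → ℝ} {fN : N → ℝ}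
    (hfMs : ContMDiff (𝓡∂ (n + 2)) 𝓘(ℝ, ℝ) ∞ fM) (hfNs : ContMDiff (𝓡∂ (n + 2)) 𝓘(ℝ, ℝ) ∞ fN)
    {a b : ℝ} {A B σ : ℝ → ℝ} (hAs : ContDiff ℝ ∞ A) (hBs : ContDiff ℝ ∞ B) (hσs : ContDiff ℝ ∞ σ)
    (hσpos : ∀ t, 0 ≤ t → σ t = 1 - B (collarStretch b t))
    (hσneg : ∀ t, t ≤ 0 → σ t = 1 + A (collarStretch a (-t)))
    (hcolM : ∀ (x : bM.carrier) (s : ℝ), 0 ≤ s → 1 - fM (G.CM.toFun x s) = collarStretch b s)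
    (hcolN : ∀ (w : bN.carrier) (s : ℝ), 0 ≤ s → 1 - fN (G.CN.toFun w s) = collarStretch a s) :
    ∃ F : G.d₂.Glued → ℝ, ContMDiff (𝓡 (n + 2)) 𝓘(ℝ, ℝ) ∞ F ∧
      (∀ p : bM.carrier × ℝ, F (G.d₂.inl (G.d₁.inl p)) = σ p.2) ∧
      (∀ x : InteriorManifold (𝓡∂ (n + 2)) M, F (G.d₂.inl (G.d₁.inr x)) = 1 - B (1 - fM x.val)) ∧
      (∀ y : InteriorManifold (𝓡∂ (n + 2)) N, F (G.d₂.inr y) = 1 + A (1 - fN y.val)) := by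
  -- the functions on the three open pieces
  set S : bM.carrier × ℝ → ℝ := fun p => σ p.2 with hS_def
  set FM : M → ℝ := fun z => 1 - B (1 - fM z) with hFM_def
  set FN : N → ℝ := fun c => 1 + A (1 - fN c) with hFN_def
  have hS : ContMDiff ((𝓡 (n + 1)).prod 𝓘(ℝ, ℝ)) 𝓘(ℝ, ℝ) ∞ S := hσs.contMDiff.comp contMDiff_snd
  have hFM : ContMDiff (𝓡∂ (n + 2)) 𝓘(ℝ, ℝ) ∞ FM :=
    (contDiff_const.sub (hBs.comp (contDiff_const.sub contDiff_id))).comp_contMDiff hfMs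
  have hFN : ContMDiff (𝓡∂ (n + 2)) 𝓘(ℝ, ℝ) ∞ FN :=
    (contDiff_const.add (hAs.comp (contDiff_const.sub contDiff_id))).comp_contMDiff hfNs
  have hFMv : ContMDiff 𝓘(ℝ, 𝔼₂) 𝓘(ℝ, ℝ) ∞ (FM ∘ (InteriorManifold.val : InteriorManifold (𝓡∂ (n + 2)) M → M)) :=
    InteriorManifold.contMDiff_comp_val hFM
  have hFNv : ContMDiff 𝓘(ℝ, 𝔼₂) 𝓘(ℝ, ℝ) ∞ (FN ∘ (InteriorManifold.val : InteriorManifold (𝓡∂ (n + 2)) N → N)) :=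
    InteriorManifold.contMDiff_comp_val hFN
  -- first descent: seam ∪ interior of `M`
  have hc₁ : ∀ p, p ∈ G.d₁.glue.source →
      S p = (FM ∘ (InteriorManifold.val : InteriorManifold (𝓡∂ (n + 2)) M → M)) (G.d₁.glue p) := by
    intro p hp
    have hp0 : 0 < p.2 := hp
    show σ p.2 = 1 - B (1 - fM (G.CM.glueHomeo p).val)
    rw [G.CM.glueHomeo_apply_val hp0, hcolM p.1 p.2 hp0.le, hσpos p.2 hp0.le]
  set F₁ : G.d₁.Glued → ℝ := G.d₁.desc S (FM ∘ InteriorManifold.val) hc₁ with hF₁_def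
  have hF₁s : ContMDiff 𝓘(ℝ, 𝔼₂) 𝓘(ℝ, ℝ) ∞ F₁ :=
    (SmoothGlueData.contMDiff_iff_comp_inl_inr (d := G.d₁)).2 ⟨hS, hFMv⟩
  -- second descent: add the interior of `N`
  have hc₂ : ∀ x, x ∈ G.d₂.glue.source →
      F₁ x = (FN ∘ (InteriorManifold.val : InteriorManifold (𝓡∂ (n + 2)) N → N)) (G.d₂.glue x) := by
    intro x hx
    rw [G.d₂_glue] at hx ⊢
    obtain ⟨p, hp, rfl⟩ := G.mem_glue₂_source_iff.1 hx
    have hp0 : 0 < -p.2 := by linarith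
    show σ p.2 = 1 + A (1 - fN (G.glue₂ (G.d₁.inl p)).val)
    rw [G.glue₂_inl, G.CN.inPt_val (p := (G.φ p.1, -p.2)) hp0, hcolN (G.φ p.1) (-p.2) hp0.le,
      hσneg p.2 hp.le]
  set F : G.d₂.Glued → ℝ := G.d₂.desc F₁ (FN ∘ InteriorManifold.val) hc₂ with hF_def
  have hFs : ContMDiff (𝓡 (n + 2)) 𝓘(ℝ, ℝ) ∞ F :=
    (SmoothGlueData.contMDiff_iff_comp_inl_inr (d := G.d₂)).2 ⟨hF₁s, hFNv⟩
  exact ⟨F, hFs, fun p => rfl, fun x => rfl, fun y => rfl⟩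

/-! ### The main theorem -/

set_option maxHeartbeats 800000 in
/-- **Adapted Morse functions glue across the seam of the model gluing.**  For compact smooth
`(n+2)`-manifolds with nonempty boundary `M`, `N`, Morse functions `f_M`, `f_N` adapted to the
boundary and a diffeomorphism `φ : ∂M ≅ ∂N`, there are gluing data `G` with `G.φ = φ` (the flow-out
collars of `1 - f_M`, `1 - f_N`) and a MORSE function `F` on the glued manifold
`G.d₂.Glued = M ∪_φ N` with `#Crit_i(F) = #Crit_i(f_M) + #Crit_j(f_N)` whenever `i + j = n + 2`.
Milnor (1965), §1 and proof of Thm. 3.4 (height collars), Milnor (1963), §2 (index in any chart);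
the classical "Morse functions of composable cobordisms glue". [cite: MilnorHCobordism1965, §1 and proof of Thm. 3.4] -/
theorem exists_isMorse_glued {fM : M → ℝ} (hfM : IsMorseAdapted (𝓡∂ (n + 2)) fM)
    {fN : N → ℝ} (hfN : IsMorseAdapted (𝓡∂ (n + 2)) fN)
    (φ : bM.carrier ≃ₘ⟮𝓡 (n + 1), 𝓡 (n + 1)⟯ bN.carrier) :
    ∃ (G : BoundaryGlueData bM bN) (F : G.d₂.Glued → ℝ), G.φ = φ ∧ IsMorse (𝓡 (n + 2)) F ∧
      ∀ i j : ℕ, i + j = n + 2 →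
        (criticalSetOfIndex (𝓡 (n + 2)) F i).ncard =
          (criticalSetOfIndex (𝓡∂ (n + 2)) fM i).ncard + (criticalSetOfIndex (𝓡∂ (n + 2)) fN j).ncard := by
  classical
  -- (0) flow-out collars of `1 - fM`, `1 - fN`; the profile
  obtain ⟨DM, hDM⟩ := hfM.exists_flowoutInput_f_eq
  obtain ⟨ΓM⟩ := DM.nonempty_cover
  obtain ⟨DN, hDN⟩ := hfN.exists_flowoutInput_f_eq
  obtain ⟨ΓN⟩ := DN.nonempty_cover
  let G : BoundaryGlueData bM bN := ⟨ΓM.openCollar bM, ΓN.openCollar bN, φ⟩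
  obtain ⟨A, B, σ, hAs, hBs, hσs, hAd, hBd, hσd, hA1, hB1, hσpos, hσneg⟩ :=
    exists_seamProfile ΓN.a_pos ΓM.a_pos
  have hcolM : ∀ (x : bM.carrier) (s : ℝ), 0 ≤ s → 1 - fM (G.CM.toFun x s) = collarStretch ΓM.a s := by
    intro x s hs
    have h := ΓM.f_Fl_incl_collarStretch bM x hs
    simp only [hDM] at h
    exact h
  have hcolN : ∀ (w : bN.carrier) (s : ℝ), 0 ≤ s → 1 - fN (G.CN.toFun w s) = collarStretch ΓN.a s := by
    intro w s hs
    have h := ΓN.f_Fl_incl_collarStretch bN w hs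
    simp only [hDN] at h
    exact h
  obtain ⟨F, hFs, hFseam, hFM, hFN⟩ := exists_glued_function G hfM.isMorse.contMDiff hfN.isMorse.contMDiff
    hAs hBs hσs hσpos hσneg hcolM hcolN
  haveI : IsManifold (𝓡 (n + 2)) 2 G.d₂.Glued := IsManifold.of_le (n := ∞) (by norm_cast)
  haveI : IsManifold 𝓘(ℝ, 𝔼₂) 2 G.d₁.Glued := IsManifold.of_le (n := ∞) (by norm_cast)
  -- abbreviations for the restrictions
  have hFinl : F ∘ G.d₂.inl = fun x => F (G.d₂.inl x) := rfl
  have hrestN : F ∘ G.d₂.inr = (fun c => 1 + A (1 - fN c)) ∘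
      (InteriorManifold.val : InteriorManifold (𝓡∂ (n + 2)) N → N) := by
    funext y; exact hFN y
  have hrestM : (F ∘ G.d₂.inl) ∘ G.d₁.inr = (fun z => 1 - B (1 - fM z)) ∘
      (InteriorManifold.val : InteriorManifold (𝓡∂ (n + 2)) M → M) := by
    funext x; exact hFM x
  have hrestS : (F ∘ G.d₂.inl) ∘ G.d₁.inl = fun p : bM.carrier × ℝ => σ p.2 := by
    funext p; exact hFseam p
  have hFMfun : ContMDiff (𝓡∂ (n + 2)) 𝓘(ℝ, ℝ) ∞ (fun z => 1 - B (1 - fM z)) :=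
    (contDiff_const.sub (hBs.comp (contDiff_const.sub contDiff_id))).comp_contMDiff hfM.isMorse.contMDiff
  have hFNfun : ContMDiff (𝓡∂ (n + 2)) 𝓘(ℝ, ℝ) ∞ (fun c => 1 + A (1 - fN c)) :=
    (contDiff_const.add (hAs.comp (contDiff_const.sub contDiff_id))).comp_contMDiff hfN.isMorse.contMDiff
  have hdM : ∀ z, MDifferentiableAt (𝓡∂ (n + 2)) 𝓘(ℝ, ℝ) fM z := fun z =>
    hfM.isMorse.contMDiff.mdifferentiableAt (by simp)
  have hdN : ∀ z, MDifferentiableAt (𝓡∂ (n + 2)) 𝓘(ℝ, ℝ) fN z := fun z =>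
    hfN.isMorse.contMDiff.mdifferentiableAt (by simp)
  have hFd : ∀ q, MDifferentiableAt (𝓡 (n + 2)) 𝓘(ℝ, ℝ) F q := fun q => hFs.mdifferentiableAt (by simp)
  have hF2 : ∀ q, ContMDiffAt (𝓡 (n + 2)) 𝓘(ℝ, ℝ) 2 F q := fun q => hFs.contMDiffAt.of_le (by norm_cast)
  have hF₁s : ContMDiff 𝓘(ℝ, 𝔼₂) 𝓘(ℝ, ℝ) ∞ (F ∘ G.d₂.inl) := hFs.comp G.d₂.contMDiff_inl
  have hF₁d : ∀ x, MDifferentiableAt 𝓘(ℝ, 𝔼₂) 𝓘(ℝ, ℝ) (F ∘ G.d₂.inl) x := fun x =>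
    hF₁s.mdifferentiableAt (by simp)
  have hF₁2 : ∀ x, ContMDiffAt 𝓘(ℝ, 𝔼₂) 𝓘(ℝ, ℝ) 2 (F ∘ G.d₂.inl) x := fun x =>
    hF₁s.contMDiffAt.of_le (by norm_cast)
  -- (1) criticality on the three pieces
  have hcritN : ∀ y : InteriorManifold (𝓡∂ (n + 2)) N,
      IsMCriticalPt (𝓡 (n + 2)) F (G.d₂.inr y) ↔ IsMCriticalPt (𝓡∂ (n + 2)) fN y.val := by
    intro y
    rw [SmoothGlueData.isMCriticalPt_inr_iff (hFd _), hrestN,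
      InteriorManifold.isMCriticalPt_comp_val_iff (f := fun c => 1 + A (1 - fN c)) y
        (hFNfun.mdifferentiableAt (by simp)),
      isMCriticalPt_oneAddReparam_iff hAd (hdN _)]
  have hcritM : ∀ x : InteriorManifold (𝓡∂ (n + 2)) M,
      IsMCriticalPt (𝓡 (n + 2)) F (G.d₂.inl (G.d₁.inr x)) ↔ IsMCriticalPt (𝓡∂ (n + 2)) fM x.val := by
    intro x
    rw [SmoothGlueData.isMCriticalPt_inl_iff (hFd _), SmoothGlueData.isMCriticalPt_inr_iff (hF₁d _),
      hrestM, InteriorManifold.isMCriticalPt_comp_val_iff (f := fun z => 1 - B (1 - fM z)) x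
        (hFMfun.mdifferentiableAt (by simp)),
      isMCriticalPt_oneSubReparam_iff hBd (hdM _)]
  have hcritS : ∀ p : bM.carrier × ℝ, ¬ IsMCriticalPt (𝓡 (n + 2)) F (G.d₂.inl (G.d₁.inl p)) := by
    intro p hc
    rw [SmoothGlueData.isMCriticalPt_inl_iff (hFd _), SmoothGlueData.isMCriticalPt_inl_iff (hF₁d _),
      hrestS] at hc
    exact not_isMCriticalPt_comp_snd hσs (fun t => by
      obtain ⟨d, hd, hd'⟩ := hσd t; exact ⟨d, hd.ne, hd'⟩) p hc
  -- (2) critical points of `fM`, `fN` are interior and lie outside the collar regions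
  have hintM : ∀ z, IsMCriticalPt (𝓡∂ (n + 2)) fM z → (𝓡∂ (n + 2)).IsInteriorPoint z := by
    intro z hz
    by_contra h
    have hb : z ∈ (𝓡∂ (n + 2)).boundary M :=
      ((𝓡∂ (n + 2)).isInteriorPoint_or_isBoundaryPoint z).resolve_left h
    exact (hfM.2.1 z hb).2 hz
  have hintN : ∀ z, IsMCriticalPt (𝓡∂ (n + 2)) fN z → (𝓡∂ (n + 2)).IsInteriorPoint z := by
    intro z hz
    by_contra h
    have hb : z ∈ (𝓡∂ (n + 2)).boundary N :=
      ((𝓡∂ (n + 2)).isInteriorPoint_or_isBoundaryPoint z).resolve_left h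
    exact (hfN.2.1 z hb).2 hz
  have houtM : ∀ z, IsMCriticalPt (𝓡∂ (n + 2)) fM z → ΓM.a ≤ 1 - fM z := by
    intro z hz
    by_contra hle
    have hlt : 1 - fM z < ΓM.a := lt_of_not_ge hle
    have hreg : z ∈ G.CM.region := by
      show DM.f z < ΓM.a
      simp only [hDM]; exact hlt
    have hzi := hintM z hz
    have hkey : G.d₁.inl (G.CM.projHeight z) = G.d₁.inr ⟨z, hzi⟩ := G.inl_projHeight_eq_inr hreg hzi
    have hc : IsMCriticalPt (𝓡 (n + 2)) F (G.d₂.inl (G.d₁.inr ⟨z, hzi⟩)) := (hcritM ⟨z, hzi⟩).2 hz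
    rw [← hkey] at hc
    exact hcritS _ hc
  have houtN : ∀ z, IsMCriticalPt (𝓡∂ (n + 2)) fN z → ΓN.a ≤ 1 - fN z := by
    intro z hz
    by_contra hle
    have hlt : 1 - fN z < ΓN.a := lt_of_not_ge hle
    have hreg : z ∈ G.CN.region := by
      show DN.f z < ΓN.a
      simp only [hDN]; exact hlt
    have hzi := hintN z hz
    -- `jN z` is a seam-piece point and also `inr ⟨z, _⟩`
    have hkey : G.d₂.inl (G.d₁.inl (G.φ.symm (G.CN.proj z), -G.CN.height z)) = G.d₂.inr ⟨z, hzi⟩ :=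
      G.inl_inl_eq_inr hreg hzi
    have hc : IsMCriticalPt (𝓡 (n + 2)) F (G.d₂.inr ⟨z, hzi⟩) := (hcritN ⟨z, hzi⟩).2 hz
    rw [← hkey] at hc
    exact hcritS _ hc
  -- (3) local affine forms near the critical points, on the pieces
  have hlocM : ∀ z, IsMCriticalPt (𝓡∂ (n + 2)) fM z →
      (fun z => 1 - B (1 - fM z)) =ᶠ[𝓝 z] fun y => 8 / (7 * ΓM.a) * fM y + (1 - 8 / (7 * ΓM.a)) := by
    intro z hz
    have hopen : IsOpen {y : M | 3 * ΓM.a / 32 < 1 - fM y} :=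
      isOpen_lt continuous_const (continuous_const.sub hfM.isMorse.contMDiff.continuous)
    have hzmem : z ∈ {y : M | 3 * ΓM.a / 32 < 1 - fM y} := by
      show 3 * ΓM.a / 32 < 1 - fM z
      linarith [houtM z hz, ΓM.a_pos]
    filter_upwards [hopen.mem_nhds hzmem] with y hy
    rw [hB1 _ (le_of_lt hy)]
    have ha : (7 : ℝ) * ΓM.a ≠ 0 := mul_ne_zero (by norm_num) ΓM.a_pos.ne'
    field_simp
    ring
  have hlocN : ∀ z, IsMCriticalPt (𝓡∂ (n + 2)) fN z →
      (fun z => 1 + A (1 - fN z)) =ᶠ[𝓝 z] fun y => (1 + 8 / (7 * ΓN.a)) - 8 / (7 * ΓN.a) * fN y := by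
    intro z hz
    have hopen : IsOpen {y : N | 3 * ΓN.a / 32 < 1 - fN y} :=
      isOpen_lt continuous_const (continuous_const.sub hfN.isMorse.contMDiff.continuous)
    have hzmem : z ∈ {y : N | 3 * ΓN.a / 32 < 1 - fN y} := by
      show 3 * ΓN.a / 32 < 1 - fN z
      linarith [houtN z hz, ΓN.a_pos]
    filter_upwards [hopen.mem_nhds hzmem] with y hy
    rw [hA1 _ (le_of_lt hy)]
    have ha : (7 : ℝ) * ΓN.a ≠ 0 := mul_ne_zero (by norm_num) ΓN.a_pos.ne'
    field_simp
    ring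
  have hcM : 0 < 8 / (7 * ΓM.a) := by have := ΓM.a_pos; positivity
  have hcN : 0 < 8 / (7 * ΓN.a) := by have := ΓN.a_pos; positivity
  haveI : FiniteDimensional ℝ 𝔼₂ := inferInstance
  -- (4) Morse data of `F` at its critical points
  have hchartG : ∀ q : G.d₁.Glued, chartAt (EuclideanSpace ℝ (Fin (n + 1 + 1))) q ∈
      IsManifold.maximalAtlas 𝓘(ℝ, EuclideanSpace ℝ (Fin (n + 1 + 1))) ∞ G.d₁.Glued := fun q =>
    IsManifold.chart_mem_maximalAtlas q
  have hchartM : ∀ x : InteriorManifold (𝓡∂ (n + 2)) M, chartAt 𝔼₂ x ∈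
      IsManifold.maximalAtlas 𝓘(ℝ, 𝔼₂) ∞ (InteriorManifold (𝓡∂ (n + 2)) M) := fun x =>
    IsManifold.chart_mem_maximalAtlas x
  have hchartN : ∀ y : InteriorManifold (𝓡∂ (n + 2)) N, chartAt 𝔼₂ y ∈
      IsManifold.maximalAtlas 𝓘(ℝ, 𝔼₂) ∞ (InteriorManifold (𝓡∂ (n + 2)) N) := fun y =>
    IsManifold.chart_mem_maximalAtlas y
  have hdataM : ∀ x : InteriorManifold (𝓡∂ (n + 2)) M, IsMCriticalPt (𝓡∂ (n + 2)) fM x.val →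
      (mhessian (𝓡 (n + 2)) F (G.d₂.inl (G.d₁.inr x))).Nondegenerate ∧
        morseIndex (𝓡 (n + 2)) F (G.d₂.inl (G.d₁.inr x)) = morseIndex (𝓡∂ (n + 2)) fM x.val := by
    intro x hx
    obtain ⟨-, hnd, hidx⟩ := morseData_of_eventuallyEq_pos_affine hfM.isMorse hcM (hlocM x.val hx) hx
    have hcF : IsMCriticalPt (𝓡 (n + 2)) F (G.d₂.inl (G.d₁.inr x)) := (hcritM x).2 hx
    have hcF₁ : IsMCriticalPt 𝓘(ℝ, 𝔼₂) (F ∘ G.d₂.inl) (G.d₁.inr x) :=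
      (SmoothGlueData.isMCriticalPt_inl_iff (hFd _)).1 hcF
    -- nondegeneracy / index: `F` at `inl (inr x)`  ↝  `F ∘ inl` at `inr x`  ↝  `FM ∘ val` at `x`  ↝  `FM` at `x.val`
    have e1 : (mhessian (𝓡 (n + 2)) F (G.d₂.inl (G.d₁.inr x))).Nondegenerate ↔
        (mhessian 𝓘(ℝ, 𝔼₂) (F ∘ G.d₂.inl) (G.d₁.inr x)).Nondegenerate := by
      rw [SmoothGlueData.nondegenerate_mhessian_inl_iff (hF2 _) hcF (hchartG _) (mem_chart_source _ _),
        hessianInChart_chartAt]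
    have e2 : (mhessian 𝓘(ℝ, 𝔼₂) (F ∘ G.d₂.inl) (G.d₁.inr x)).Nondegenerate ↔
        (mhessian 𝓘(ℝ, 𝔼₂) ((fun z => 1 - B (1 - fM z)) ∘
          (InteriorManifold.val : InteriorManifold (𝓡∂ (n + 2)) M → M)) x).Nondegenerate := by
      rw [SmoothGlueData.nondegenerate_mhessian_inr_iff (hF₁2 _) hcF₁ (hchartM x) (mem_chart_source _ _),
        hessianInChart_chartAt, hrestM]
    have e3 := InteriorManifold.nondegenerate_mhessian_comp_val_iff (fun z => 1 - B (1 - fM z)) x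
    have i1 : morseIndex (𝓡 (n + 2)) F (G.d₂.inl (G.d₁.inr x)) =
        morseIndex 𝓘(ℝ, 𝔼₂) (F ∘ G.d₂.inl) (G.d₁.inr x) := SmoothGlueData.morseIndex_inl_eq (hF2 _) hcF
    have i2 : morseIndex 𝓘(ℝ, 𝔼₂) (F ∘ G.d₂.inl) (G.d₁.inr x) =
        morseIndex 𝓘(ℝ, 𝔼₂) ((fun z => 1 - B (1 - fM z)) ∘
          (InteriorManifold.val : InteriorManifold (𝓡∂ (n + 2)) M → M)) x := by
      rw [SmoothGlueData.morseIndex_inr_eq (hF₁2 _) hcF₁, hrestM]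
    have i3 := InteriorManifold.morseIndex_comp_val (fun z => 1 - B (1 - fM z)) x
    exact ⟨e1.2 (e2.2 (e3.2 hnd)), by rw [i1, i2, i3]; exact hidx⟩
  have hdataN : ∀ y : InteriorManifold (𝓡∂ (n + 2)) N, IsMCriticalPt (𝓡∂ (n + 2)) fN y.val →
      (mhessian (𝓡 (n + 2)) F (G.d₂.inr y)).Nondegenerate ∧
        morseIndex (𝓡 (n + 2)) F (G.d₂.inr y) + morseIndex (𝓡∂ (n + 2)) fN y.val = n + 2 := by
    intro y hy
    obtain ⟨-, hnd, hidx⟩ := morseData_of_eventuallyEq_const_sub_affine hfN.isMorse hcN (hlocN y.val hy) hy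
    have hcF : IsMCriticalPt (𝓡 (n + 2)) F (G.d₂.inr y) := (hcritN y).2 hy
    have e1 : (mhessian (𝓡 (n + 2)) F (G.d₂.inr y)).Nondegenerate ↔
        (mhessian 𝓘(ℝ, 𝔼₂) ((fun c => 1 + A (1 - fN c)) ∘
          (InteriorManifold.val : InteriorManifold (𝓡∂ (n + 2)) N → N)) y).Nondegenerate := by
      rw [SmoothGlueData.nondegenerate_mhessian_inr_iff (hF2 _) hcF (hchartN y) (mem_chart_source _ _),
        hessianInChart_chartAt, hrestN]
    have e2 := InteriorManifold.nondegenerate_mhessian_comp_val_iff (fun c => 1 + A (1 - fN c)) y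
    have i1 : morseIndex (𝓡 (n + 2)) F (G.d₂.inr y) =
        morseIndex 𝓘(ℝ, 𝔼₂) ((fun c => 1 + A (1 - fN c)) ∘
          (InteriorManifold.val : InteriorManifold (𝓡∂ (n + 2)) N → N)) y := by
      rw [SmoothGlueData.morseIndex_inr_eq (hF2 _) hcF, hrestN]
    have i2 := InteriorManifold.morseIndex_comp_val (fun c => 1 + A (1 - fN c)) y
    rw [finrank_euclideanSpace_fin] at hidx
    exact ⟨e1.2 (e2.2 hnd), by rw [i1, i2]; exact hidx⟩
  -- (5) `F` is Morse
  have hMorse : IsMorse (𝓡 (n + 2)) F := by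
    refine ⟨hFs, fun q hq => ?_⟩
    rcases G.d₂.exists_inl_or_inr q with ⟨x, rfl⟩ | ⟨y, rfl⟩
    · rcases G.d₁.exists_inl_or_inr x with ⟨p, rfl⟩ | ⟨x', rfl⟩
      · exact absurd hq (hcritS p)
      · exact (hdataM x' ((hcritM x').1 hq)).1
    · exact (hdataN y ((hcritN y).1 hq)).1
  -- (6) counting
  refine ⟨G, F, rfl, hMorse, fun i j hij => ?_⟩
  set eM : InteriorManifold (𝓡∂ (n + 2)) M → G.d₂.Glued := fun x => G.d₂.inl (G.d₁.inr x) with heM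
  set TM : Set (InteriorManifold (𝓡∂ (n + 2)) M) :=
    (InteriorManifold.val) ⁻¹' criticalSetOfIndex (𝓡∂ (n + 2)) fM i with hTM
  set TN : Set (InteriorManifold (𝓡∂ (n + 2)) N) :=
    (InteriorManifold.val) ⁻¹' criticalSetOfIndex (𝓡∂ (n + 2)) fN j with hTN
  have hset : criticalSetOfIndex (𝓡 (n + 2)) F i = eM '' TM ∪ G.d₂.inr '' TN := by
    ext q
    simp only [mem_criticalSetOfIndex, mem_union, mem_image, hTM, hTN, mem_preimage, heM]
    constructor
    · rintro ⟨hq, hqi⟩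
      rcases G.d₂.exists_inl_or_inr q with ⟨x, rfl⟩ | ⟨y, rfl⟩
      · rcases G.d₁.exists_inl_or_inr x with ⟨p, rfl⟩ | ⟨x', rfl⟩
        · exact absurd hq (hcritS p)
        · have hx' := (hcritM x').1 hq
          exact Or.inl ⟨x', ⟨hx', by rw [← (hdataM x' hx').2, hqi]⟩, rfl⟩
      · have hy := (hcritN y).1 hq
        refine Or.inr ⟨y, ⟨hy, ?_⟩, rfl⟩
        have h := (hdataN y hy).2
        omega
    · rintro (⟨x', ⟨hx', hxi⟩, rfl⟩ | ⟨y, ⟨hy, hyj⟩, rfl⟩)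
      · exact ⟨(hcritM x').2 hx', by rw [(hdataM x' hx').2, hxi]⟩
      · refine ⟨(hcritN y).2 hy, ?_⟩
        have h := (hdataN y hy).2
        omega
  have hinjM : Injective eM := fun x x' h => G.d₁.inr_injective (G.d₂.inl_injective h)
  have hinjN : Injective (G.d₂.inr : InteriorManifold (𝓡∂ (n + 2)) N → G.d₂.Glued) := G.d₂.inr_injective
  have hvalM : Injective (InteriorManifold.val : InteriorManifold (𝓡∂ (n + 2)) M → M) :=
    InteriorManifold.val_injective
  have hvalN : Injective (InteriorManifold.val : InteriorManifold (𝓡∂ (n + 2)) N → N) :=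
    InteriorManifold.val_injective
  have hfinM : (criticalSetOfIndex (𝓡∂ (n + 2)) fM i).Finite :=
    (IsMorse.finite_criticalSet_holds hfM.isMorse).subset (criticalSetOfIndex_subset _ _ _)
  have hfinN : (criticalSetOfIndex (𝓡∂ (n + 2)) fN j).Finite :=
    (IsMorse.finite_criticalSet_holds hfN.isMorse).subset (criticalSetOfIndex_subset _ _ _)
  have hTMfin : TM.Finite := hfinM.preimage (hvalM.injOn)
  have hTNfin : TN.Finite := hfinN.preimage (hvalN.injOn)
  have hdisj : Disjoint (eM '' TM) (G.d₂.inr '' TN) := by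
    refine disjoint_left.2 ?_
    rintro _ ⟨x, -, rfl⟩ ⟨y, -, hy⟩
    exact G.inl_inr_ne_inr x y hy.symm
  have hsubM : criticalSetOfIndex (𝓡∂ (n + 2)) fM i ⊆ range (InteriorManifold.val : InteriorManifold (𝓡∂ (n + 2)) M → M) := by
    intro z hz
    exact ⟨⟨z, hintM z hz.1⟩, rfl⟩
  have hsubN : criticalSetOfIndex (𝓡∂ (n + 2)) fN j ⊆ range (InteriorManifold.val : InteriorManifold (𝓡∂ (n + 2)) N → N) := by
    intro z hz
    exact ⟨⟨z, hintN z hz.1⟩, rfl⟩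
  rw [hset, ncard_union_eq hdisj (hTMfin.image _) (hTNfin.image _), ncard_image_of_injective _ hinjM,
    ncard_image_of_injective _ hinjN, hTM, hTN, ncard_preimage_of_injective_subset_range hvalM hsubM,
    ncard_preimage_of_injective_subset_range hvalN hsubN]

end Summit.SmoothPoincare4.SmoothPoincare4.Theorems.AcyclicBisectionRigidity.SeamGluing

end
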